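import Summits.BirchSwinnertonDyer.BirchSwinnertonDyer.Theorems.PrintCf2SplitBadTwoHalvesOfHeegnerIndexSmallConductor
import Summits.BirchSwinnertonDyer.BirchSwinnertonDyer.Theorems.PrintCf2SplitBadTwoHalvesOverTwistField
import Summits.BirchSwinnertonDyer.BirchSwinnertonDyer.Theorems.PrintCf2SplitBadTwoHalvesOverCMField
import HarnessLib

/-!
# UPPER twin of the stub-critic's T0: the registered v3 stub `stub_heegnerIndexUpperAtTwo` (crux `PrintCf2.SplitBadTwoUpperHalfOfFacts`,
# stmt-BirchSwinnertonDyer-27850, line `heegner_index_two` UPPER, skeleton 982583d579df569b) ⟸ the ℚ-side / twist-field / CM-field UPPER halves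

Seat `leafhand-bsd-printcf2-2` g0 (prover, 2026-08-30), `--supports stmt-BirchSwinnertonDyer-27850` (helper; closes no item and no stub — the
registered `stub_heegnerIndexUpperAtTwo` stays open). THEOREMS ONLY, no `sorry`, no definitions, no named facts. Token-for-token mirror of
the LOWER certificate `Theorems/PrintCf2SplitBadTwoLowerStubGlue.lean` (stub-critic g0's STUB-PLAN T0) in the «Euler-system / Kolyvagin
direction»: the ℚ-side upper half `MissingUpperBoundAt W 2` of ONE curve of analytic rank one, plus the twin's `BSD₂` at every Heegner field
with `L(E^{(d_K)},1) ≠ 0`, give the index-currency UPPER bound `ord₂ #Ш(E/K)[2^∞] + ord₂ c_K ≤ 2·ord₂[E(K):ℤP] − 2·ord₂ c` on every Heegner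
frame with `d_K < −4`, `P` non-torsion (§1: Milne (★) `exists_shaAn_valuation_sub_eq_of_bsdp_twist` + the Gross–Zagier value
`exists_shaAnOver_baseChange_eq_padicValRat_two`); hence the displayed text of `stub_heegnerIndexUpperAtTwo` follows from
`∀ class W, MissingUpperBoundAt W 2` (§2), from the twist-field upper halves of p643613 (§3) and from the CM-field upper halves of p641230
(§4); §5 states the registered stub's TYPE verbatim from each input. Together with LEAD g8's `ByName.splitBadTwoUpperHalfOfFacts_of_heegnerIndexStub`
(stub ⟹ child) this records that the research stub and the child crux are the SAME obligation modulo the line's prints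
(`ToricPublishedInputs ∧ Milne any-model`). BSD is proved for no curve by any of this.
-/

set_option autoImplicit false
set_option linter.dupNamespace false

noncomputable section

open scoped Classical NumberField

namespace Summit.BirchSwinnertonDyer.BirchSwinnertonDyer.Theorems.PrintCf2.UpperStubGlue

open WeierstrassCurve NumberField IsDedekindDomain
  Literature.NumberTheory.EllipticCurves Literature.NumberTheory.EllipticCurves.ModularForms
  Literature.NumberTheory.EllipticCurves.Rank1Residual Literature.NumberTheory.EllipticCurves.Rank1Residual.Typed
  Literature.NumberTheory.EllipticCurves.KrizLi2019
  Summit.BirchSwinnertonDyer.Rank1Residual Summit.BirchSwinnertonDyer.Rank1Residual.AdditivePotMult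
  Summit.BirchSwinnertonDyer.BirchSwinnertonDyer.Theses.UniversalToricDescent
  Summit.BirchSwinnertonDyer.BirchSwinnertonDyer.Theorems.PrintCf2.EisensteinTwo
  Summit.BirchSwinnertonDyer.BirchSwinnertonDyer.Theorems.PrintCf2.KsideFiniteTwo

/-! ### §1 ONE curve: ℚ-side upper half + twin `BSD₂` ⟹ index UPPER bound on every frame -/

/-- **`MissingUpperBoundAt W 2` ⟹ `ord₂ #Ш(E/K)[2^∞] + ord₂ c_K ≤ 2·ord₂[E(K):ℤP] − 2·ord₂ c` on every Heegner frame.**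
One-sided («Euler-system direction») twin of `KsideFiniteTwo.heegnerIndexEq_two_of_bsdp_of_twist` and of
`LowerStubGlue.heegnerIndexLower_two_of_missingLowerBoundAt_of_twist`: `W/ℚ` of analytic rank one (no CM, no conductor hypothesis),
its ℚ-side upper half in Miller's currency, and the twin's `BSD₂` on a globally minimal model of `E^{(d_K)}` at every Heegner field with
`L(E^{(d_K)},1) ≠ 0`. [cite: Milne1972ArithmeticAV, §1 Thm. 1] [cite: GrossZagier1986, Thm. I.6.3 and V.(2.2)] [cite: Miller2011LMS, Def. 1.1] -/
theorem heegnerIndexUpper_two_of_missingUpperBoundAt_of_twist (hF : ToricPublishedInputs)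
    (hMilne : Milne1972.bsdQuotient_baseChange_quadratic)
    (W : WeierstrassCurve ℚ) [W.IsElliptic] [W.IsGloballyMinimal] (hr : W.analyticRank = 1) (hQ : MissingUpperBoundAt W 2)
    (hTw : ∀ (N : ℕ) [NeZero N] (K : Type) [Field K] [NumberField K]
      (Wd : WeierstrassCurve ℚ) [Wd.IsElliptic] [Wd.IsGloballyMinimal],
      W.conductorNorm ℤ = N → IsImaginaryQuadratic K → SatisfiesHeegnerHypothesis N K →
      (∃ C : VariableChange ℚ, C • W.quadraticTwist (NumberField.discr K : ℚ) = Wd) →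
      (W.quadraticTwist (NumberField.discr K : ℚ)).entireLFunction 1 ≠ 0 → BSDp Wd 2) :
    ∀ (N : ℕ) [NeZero N] (K : Type) [Field K] [NumberField K] (Dt : ModularParametrizationData W N)
      (H : HeegnerDatum N (NumberField.discr K)) (ι : K →+* ℂ) (P : (W.baseChange K).toAffine.Point),
      W.conductorNorm ℤ = N → IsImaginaryQuadratic K → SatisfiesHeegnerHypothesis N K → NumberField.discr K < -4 →
      WeierstrassCurve.Affine.Point.map ι.toRatAlgHom P = heegnerPointComplex Dt H → ¬ IsOfFinAddOrder P →
      (padicValNat 2 (Nat.card (AddCommGroup.primaryComponent (W.baseChange K).sha 2)) : ℤ) +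
          (padicValNat 2 (W.baseChange K).tamagawaProduct : ℤ) ≤
        2 * (padicValNat 2 (AddSubgroup.zmultiples P).index : ℤ) - 2 * (padicValNat 2 Dt.c.natAbs : ℤ) := by
  intro N _ K _ _ Dt H ι P hN hK hHN hd4 hP hnt
  obtain ⟨hGZ, hKo, hGZK, hmod, -, -, -, -, -, -⟩ := hF
  subst hN
  have h2 : Module.finrank ℚ K = 2 := hK.1
  -- `L(E^{(d_K)},1) ≠ 0` from `P` non-torsion; `r_an(E_K) = 1`
  have hL0 : W.entireLFunction 1 = 0 := entireLFunction_one_eq_zero_of_analyticRank_eq_one hr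
  have hLK : LDerivEK W K ≠ 0 :=
    (lDerivEK_ne_zero_iff_not_isOfFinAddOrder W (W.conductorNorm ℤ) K (hGZ _ W K) hK hHN ⟨Dt, H, ι, hP⟩).mpr hnt
  have hLt : (W.quadraticTwist (NumberField.discr K : ℚ)).entireLFunction 1 ≠ 0 := by
    intro h0
    apply hLK
    rw [lDerivEK_eq_deriv_mul W K hmod hL0, h0, mul_zero]
  have hD0 : (NumberField.discr K : ℚ) ≠ 0 := by exact_mod_cast NumberField.discr_ne_zero K
  haveI hEt : (W.quadraticTwist (NumberField.discr K : ℚ)).IsElliptic := W.isElliptic_quadraticTwist hD0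
  have hrd0 : (W.quadraticTwist (NumberField.discr K : ℚ)).analyticRank = 0 :=
    ((W.quadraticTwist (NumberField.discr K : ℚ)).analyticRank_eq_zero_iff_holds (hmod _)).mpr hLt
  have hrK : (W.baseChange K).analyticRank = 1 :=
    (Summit.BirchSwinnertonDyer.Rank1Residual.P2.analyticRank_baseChange_eq_one_iff W K hmod h2).mpr (Or.inl ⟨hr, hrd0⟩)
  -- Gross–Zagier exact value: `ord₂ #Ш_an(E_K) = 2·ord₂ I − 2·ord₂ c − ord₂ c_K`
  obtain ⟨hShaK, q', hq', hv⟩ :=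
    exists_shaAnOver_baseChange_eq_padicValRat_two W K Dt H ι P (hGZ _ W K) (hKo _ W K) hmod hK hd4 hHN hP hrK
  haveI : Finite (W.baseChange K).sha := hShaK
  -- twin, Milne (★): the `2`-adic defects of `W/ℚ` and `E_K/K` agree
  haveI : (W.baseChange K).IsGloballyMinimal := W.isGloballyMinimal_baseChange_of_satisfiesHeegnerHypothesis K h2 hHN
  haveI : (W.baseChange K).IsElliptic := isElliptic_baseChange' W K
  obtain ⟨Cd, hCd⟩ := hasGlobalMinimalModel_rat_holds (W.quadraticTwist (NumberField.discr K : ℚ))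
  haveI : (Cd • W.quadraticTwist (NumberField.discr K : ℚ)).IsGloballyMinimal := hCd
  have hWd : BSDp (Cd • W.quadraticTwist (NumberField.discr K : ℚ)) 2 :=
    hTw (W.conductorNorm ℤ) K (Cd • W.quadraticTwist (NumberField.discr K : ℚ)) rfl hK hHN ⟨Cd, rfl⟩ hLt
  have hrW : W.analyticRank ≤ 1 := by rw [hr]
  have hrd : (Cd • W.quadraticTwist (NumberField.discr K : ℚ)).analyticRank ≤ 1 := by
    rw [analyticRank_smul, hrd0]; exact zero_le_one
  obtain ⟨q, hq, hdef⟩ := exists_shaAn_valuation_sub_eq_of_bsdp_twist W 2 K (Cd • W.quadraticTwist (NumberField.discr K : ℚ))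
    (W.baseChange K) hGZK hmod hMilne hrW h2 ⟨Cd, rfl⟩ hrd ⟨1, one_smul _ _⟩ hq' hWd
  -- the ℚ-side UPPER half (one-sided input) in place of `BSDp W 2`
  obtain ⟨q₀, hq₀, hv₀⟩ := hQ
  have hqq : q = q₀ := by exact_mod_cast hq.symm.trans hq₀
  subst hqq
  have hsha : padicValNat 2 (Nat.card (AddCommGroup.primaryComponent (W.baseChange K).sha 2)) =
      padicValNat 2 (W.baseChange K).shaOrder :=
    Literature.NumberTheory.EllipticCurves.padicValNat_card_addPrimaryComponent 2
  rw [hsha]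
  rw [hv] at hdef
  linarith

/-! ### §2 The displayed text of `stub_heegnerIndexUpperAtTwo` ⟸ `∀ class W, MissingUpperBoundAt W 2` -/

/-- **T0-UPPER (ℚ-side form).** GIVEN the line's prints `hPr` and 𝔅_split `hB` (only GZK, modularity and the CM rank-`0` twin
`bsdTriple_of_hasCM_of_L_one_ne_zero` are used), the ℚ-side UPPER halves of the class give the conclusion of the registered stub on every
Heegner frame (the displayed binders `L(E^{(d_K)},1) ≠ 0`, `r_an(E_K) = 1`, `rank E(K) = 1`, `Ш(E/K)` finite are accepted and not needed).
[cite: Milne1972ArithmeticAV, §1 Thm. 1] [cite: GrossZagier1986, V.(2.2)] [cite: BurungaleFlach2024, Thm. 1.1] -/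
theorem stubUpperText_of_forall_missingUpperBoundAt
    (hPr : (ToricPublishedInputs ∧ Milne1972.bsdQuotient_baseChange_quadratic_anyModel))
    (hB : (Literature.NumberTheory.EllipticCurves.rank_eq_analyticRank_of_analyticRank_le_one ∧ WeierstrassCurve.hasEntireLFunction_rat ∧
        WeierstrassCurve.bsdRHS_eq_of_isIsogenous ∧ Literature.NumberTheory.EllipticCurves.bsdTriple_of_hasCM_of_L_one_ne_zero ∧
        Literature.NumberTheory.EllipticCurves.KrizLi2019.thm112_bsdTwo_twist))
    (hQ : ∀ (W : WeierstrassCurve ℚ) [W.IsElliptic] [W.IsGloballyMinimal], W.HasCM → W.analyticRank = 1 → CMSplit W 2 → ¬ Good W 2 →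
      MissingUpperBoundAt W 2) :
    ∀ (W : WeierstrassCurve ℚ) [W.IsElliptic] [W.IsGloballyMinimal], W.HasCM → W.analyticRank = 1 → CMSplit W 2 → ¬ Good W 2 →
      ∀ (N : ℕ) [NeZero N] (K : Type) [Field K] [NumberField K] (Dt : ModularParametrizationData W N)
        (H : HeegnerDatum N (NumberField.discr K)) (ι : K →+* ℂ) (P : (W.baseChange K).toAffine.Point),
        W.conductorNorm ℤ = N → IsImaginaryQuadratic K → SatisfiesHeegnerHypothesis N K → NumberField.discr K < -4 →
        (W.quadraticTwist (NumberField.discr K : ℚ)).entireLFunction 1 ≠ 0 → (W.baseChange K).analyticRank = 1 →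
        WeierstrassCurve.Affine.Point.map ι.toRatAlgHom P = heegnerPointComplex Dt H → ¬ IsOfFinAddOrder P →
        (W.baseChange K).mordellWeilRank = 1 → Finite (W.baseChange K).sha →
        (padicValNat 2 (Nat.card (AddCommGroup.primaryComponent (W.baseChange K).sha 2)) : ℤ) +
            (padicValNat 2 (W.baseChange K).tamagawaProduct : ℤ) ≤
          2 * (padicValNat 2 (AddSubgroup.zmultiples P).index : ℤ) - 2 * (padicValNat 2 Dt.c.natAbs : ℤ) := by
  intro W _ _ hCM hr hs hg N _ K _ _ Dt H ι P hN hK hHN hd4 _ _ hP hnt _ _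
  have hmod : hasEntireLFunction_rat := hB.2.1
  -- the twin's `BSD₂`: `E^{(d_K)}` has CM and analytic rank `0` (Burungale–Flach), on any globally minimal model
  have hTw : ∀ (N : ℕ) [NeZero N] (K : Type) [Field K] [NumberField K]
      (Wd : WeierstrassCurve ℚ) [Wd.IsElliptic] [Wd.IsGloballyMinimal],
      W.conductorNorm ℤ = N → IsImaginaryQuadratic K → SatisfiesHeegnerHypothesis N K →
      (∃ C : VariableChange ℚ, C • W.quadraticTwist (NumberField.discr K : ℚ) = Wd) →
      (W.quadraticTwist (NumberField.discr K : ℚ)).entireLFunction 1 ≠ 0 → BSDp Wd 2 := by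
    intro N _ K _ _ Wd _ _ _ _ _ hC hLt
    obtain ⟨C, rfl⟩ := hC
    have hd : (NumberField.discr K : ℚ) ≠ 0 := by exact_mod_cast NumberField.discr_ne_zero K
    haveI hEd : (W.quadraticTwist (NumberField.discr K : ℚ)).IsElliptic := W.isElliptic_quadraticTwist hd
    have hCMd : (W.quadraticTwist (NumberField.discr K : ℚ)).HasCM := hasCM_quadraticTwist_of_hasCM W hCM hd
    have hCM' : (C • W.quadraticTwist (NumberField.discr K : ℚ)).HasCM :=
      hasCM_variableChange (W.quadraticTwist (NumberField.discr K : ℚ)) C hCMd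
    have hr0d : (W.quadraticTwist (NumberField.discr K : ℚ)).analyticRank = 0 :=
      ((W.quadraticTwist (NumberField.discr K : ℚ)).analyticRank_eq_zero_iff_holds (hmod _)).mpr hLt
    have hr0 : (C • W.quadraticTwist (NumberField.discr K : ℚ)).analyticRank = 0 := by
      rw [WeierstrassCurve.analyticRank_smul]; exact hr0d
    exact bsdp_cm_rankZero hB.2.2.2.1 hmod hCM' hr0
  exact heegnerIndexUpper_two_of_missingUpperBoundAt_of_twist hPr.1 (Milne1972.bsdQuotient_baseChange_quadratic_of_anyModel hPr.2)
    W hr (hQ W hCM hr hs hg) hTw N K Dt H ι P hN hK hHN hd4 hP hnt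

/-! ### §3 … ⟸ the twist-field UPPER halves of `BSD₂(X₀(49)_K)`, `K = ℚ(√d)`, `4 ∣ d_K` (p643613, EXACT form of road ε) -/

/-- **T0-UPPER (twist-field form).** The stub text from the over-`K` Euler-system halves for the single curve `cm7 = X₀(49)` over the
quadratic twist fields ramified at `2` — via `TwistField.splitBadTwoUpperHalfOfFacts_of_upperOverC_twistField` (child 27850) and §2. `h49` is
the tree theorem `analyticRank_cm7` fed with Coates–Li–Tian–Zhai 2015 Thm. 1.2.
[cite: Milne1972ArithmeticAV, §1 Thm. 1] [cite: CoatesLiTianZhai2015, Thm. 1.2 (r = 0)] -/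
theorem stubUpperText_of_forall_upperOverC_twistField
    (hPr : (ToricPublishedInputs ∧ Milne1972.bsdQuotient_baseChange_quadratic_anyModel))
    (hB : (Literature.NumberTheory.EllipticCurves.rank_eq_analyticRank_of_analyticRank_le_one ∧ WeierstrassCurve.hasEntireLFunction_rat ∧
        WeierstrassCurve.bsdRHS_eq_of_isIsogenous ∧ Literature.NumberTheory.EllipticCurves.bsdTriple_of_hasCM_of_L_one_ne_zero ∧
        Literature.NumberTheory.EllipticCurves.KrizLi2019.thm112_bsdTwo_twist))
    (h49 : cm7.analyticRank = 0)
    (hTF : ∀ (W : WeierstrassCurve ℚ) [W.IsElliptic] [W.IsGloballyMinimal],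
      W.j = -3375 → ¬ W.HasGoodReductionAtPrime 2 → W.analyticRank = 1 →
      ∀ (K : Type) [Field K] [NumberField K], Module.finrank ℚ K = 2 → 4 ∣ NumberField.discr K →
        (∃ C : VariableChange ℚ, C • W.quadraticTwist (NumberField.discr K : ℚ) = cm7) →
        MissingUpperBoundOverCAt (W.baseChange K) 2) :
    ∀ (W : WeierstrassCurve ℚ) [W.IsElliptic] [W.IsGloballyMinimal], W.HasCM → W.analyticRank = 1 → CMSplit W 2 → ¬ Good W 2 →
      ∀ (N : ℕ) [NeZero N] (K : Type) [Field K] [NumberField K] (Dt : ModularParametrizationData W N)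
        (H : HeegnerDatum N (NumberField.discr K)) (ι : K →+* ℂ) (P : (W.baseChange K).toAffine.Point),
        W.conductorNorm ℤ = N → IsImaginaryQuadratic K → SatisfiesHeegnerHypothesis N K → NumberField.discr K < -4 →
        (W.quadraticTwist (NumberField.discr K : ℚ)).entireLFunction 1 ≠ 0 → (W.baseChange K).analyticRank = 1 →
        WeierstrassCurve.Affine.Point.map ι.toRatAlgHom P = heegnerPointComplex Dt H → ¬ IsOfFinAddOrder P →
        (W.baseChange K).mordellWeilRank = 1 → Finite (W.baseChange K).sha →
        (padicValNat 2 (Nat.card (AddCommGroup.primaryComponent (W.baseChange K).sha 2)) : ℤ) +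
            (padicValNat 2 (W.baseChange K).tamagawaProduct : ℤ) ≤
          2 * (padicValNat 2 (AddSubgroup.zmultiples P).index : ℤ) - 2 * (padicValNat 2 Dt.c.natAbs : ℤ) :=
  stubUpperText_of_forall_missingUpperBoundAt hPr hB
    (fun W _ _ hCM hr hs hg ↦ TwistField.splitBadTwoUpperHalfOfFacts_of_upperOverC_twistField hPr.2 h49 hTF hB W hCM hr hs hg)

/-! ### §4 … ⟸ the CM-field UPPER halves over `K₀ = ℚ(√−7)` (p641230) -/

/-- **T0-UPPER (CM-field form).** The stub text from `MissingUpperBoundOverCAt (W.baseChange K₀) 2` at the CM field (`d_{K₀} = −7`) for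
every class member — via `CMFieldDescent.splitBadTwoUpperHalfOfFacts_of_upperOverCMField` and §2; `hGZ` = Gross–Zagier I.(7.3) (rationality
of `#Ш_an` over `K₀`). [cite: GrossZagier1986, Thm. I.(7.3)] [cite: Milne1972ArithmeticAV, §1 Thm. 1] -/
theorem stubUpperText_of_forall_upperOverCMField
    (hPr : (ToricPublishedInputs ∧ Milne1972.bsdQuotient_baseChange_quadratic_anyModel))
    (hB : (Literature.NumberTheory.EllipticCurves.rank_eq_analyticRank_of_analyticRank_le_one ∧ WeierstrassCurve.hasEntireLFunction_rat ∧
        WeierstrassCurve.bsdRHS_eq_of_isIsogenous ∧ Literature.NumberTheory.EllipticCurves.bsdTriple_of_hasCM_of_L_one_ne_zero ∧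
        Literature.NumberTheory.EllipticCurves.KrizLi2019.thm112_bsdTwo_twist))
    (hGZ : GrossZagier1986_thm_I_7_3)
    (hK0 : ∀ (W : WeierstrassCurve ℚ) [W.IsElliptic] [W.IsGloballyMinimal], W.HasCM → W.analyticRank = 1 →
      CMSplit W 2 → ¬ Good W 2 → ∀ (K : Type) [Field K] [NumberField K], IsImaginaryQuadratic K →
      NumberField.discr K = -7 → MissingUpperBoundOverCAt (W.baseChange K) 2) :
    ∀ (W : WeierstrassCurve ℚ) [W.IsElliptic] [W.IsGloballyMinimal], W.HasCM → W.analyticRank = 1 → CMSplit W 2 → ¬ Good W 2 →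
      ∀ (N : ℕ) [NeZero N] (K : Type) [Field K] [NumberField K] (Dt : ModularParametrizationData W N)
        (H : HeegnerDatum N (NumberField.discr K)) (ι : K →+* ℂ) (P : (W.baseChange K).toAffine.Point),
        W.conductorNorm ℤ = N → IsImaginaryQuadratic K → SatisfiesHeegnerHypothesis N K → NumberField.discr K < -4 →
        (W.quadraticTwist (NumberField.discr K : ℚ)).entireLFunction 1 ≠ 0 → (W.baseChange K).analyticRank = 1 →
        WeierstrassCurve.Affine.Point.map ι.toRatAlgHom P = heegnerPointComplex Dt H → ¬ IsOfFinAddOrder P →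
        (W.baseChange K).mordellWeilRank = 1 → Finite (W.baseChange K).sha →
        (padicValNat 2 (Nat.card (AddCommGroup.primaryComponent (W.baseChange K).sha 2)) : ℤ) +
            (padicValNat 2 (W.baseChange K).tamagawaProduct : ℤ) ≤
          2 * (padicValNat 2 (AddSubgroup.zmultiples P).index : ℤ) - 2 * (padicValNat 2 Dt.c.natAbs : ℤ) :=
  stubUpperText_of_forall_missingUpperBoundAt hPr hB
    (fun W _ _ hCM hr hs hg ↦ CMFieldDescent.splitBadTwoUpperHalfOfFacts_of_upperOverCMField hPr.2 hGZ hK0 hB W hCM hr hs hg)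

/-! ### §5 The registered stub's TYPE (v3 `heegner_index_two` UPPER, skeleton 982583d579df569b, VERBATIM) from each input -/

/-- `stub_heegnerIndexUpperAtTwo` — its displayed type verbatim — from the ℚ-side UPPER halves of the class. -/
theorem stub_heegnerIndexUpperAtTwo_of_forall_missingUpperBoundAt
    (hQ : ∀ (W : WeierstrassCurve ℚ) [W.IsElliptic] [W.IsGloballyMinimal], W.HasCM → W.analyticRank = 1 → CMSplit W 2 → ¬ Good W 2 →
      MissingUpperBoundAt W 2) :
    (ToricPublishedInputs ∧ Milne1972.bsdQuotient_baseChange_quadratic_anyModel) →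
      (Literature.NumberTheory.EllipticCurves.rank_eq_analyticRank_of_analyticRank_le_one ∧ WeierstrassCurve.hasEntireLFunction_rat ∧
        WeierstrassCurve.bsdRHS_eq_of_isIsogenous ∧ Literature.NumberTheory.EllipticCurves.bsdTriple_of_hasCM_of_L_one_ne_zero ∧
        Literature.NumberTheory.EllipticCurves.KrizLi2019.thm112_bsdTwo_twist) →
    ∀ (W : WeierstrassCurve ℚ) [W.IsElliptic] [W.IsGloballyMinimal], W.HasCM → W.analyticRank = 1 → CMSplit W 2 → ¬ Good W 2 →
      ∀ (N : ℕ) [NeZero N] (K : Type) [Field K] [NumberField K] (Dt : ModularParametrizationData W N)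
        (H : HeegnerDatum N (NumberField.discr K)) (ι : K →+* ℂ) (P : (W.baseChange K).toAffine.Point),
        W.conductorNorm ℤ = N → IsImaginaryQuadratic K → SatisfiesHeegnerHypothesis N K → NumberField.discr K < -4 →
        (W.quadraticTwist (NumberField.discr K : ℚ)).entireLFunction 1 ≠ 0 → (W.baseChange K).analyticRank = 1 →
        WeierstrassCurve.Affine.Point.map ι.toRatAlgHom P = heegnerPointComplex Dt H → ¬ IsOfFinAddOrder P →
        (W.baseChange K).mordellWeilRank = 1 → Finite (W.baseChange K).sha →
        (padicValNat 2 (Nat.card (AddCommGroup.primaryComponent (W.baseChange K).sha 2)) : ℤ) +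
            (padicValNat 2 (W.baseChange K).tamagawaProduct : ℤ) ≤
          2 * (padicValNat 2 (AddSubgroup.zmultiples P).index : ℤ) - 2 * (padicValNat 2 Dt.c.natAbs : ℤ) :=
  fun hPr hB ↦ stubUpperText_of_forall_missingUpperBoundAt hPr hB hQ

/-- `stub_heegnerIndexUpperAtTwo` — its displayed type verbatim — from the twist-field UPPER halves (p643613 exact form) and `r_an(cm7) = 0`. -/
theorem stub_heegnerIndexUpperAtTwo_of_forall_upperOverC_twistField (h49 : cm7.analyticRank = 0)
    (hTF : ∀ (W : WeierstrassCurve ℚ) [W.IsElliptic] [W.IsGloballyMinimal],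
      W.j = -3375 → ¬ W.HasGoodReductionAtPrime 2 → W.analyticRank = 1 →
      ∀ (K : Type) [Field K] [NumberField K], Module.finrank ℚ K = 2 → 4 ∣ NumberField.discr K →
        (∃ C : VariableChange ℚ, C • W.quadraticTwist (NumberField.discr K : ℚ) = cm7) →
        MissingUpperBoundOverCAt (W.baseChange K) 2) :
    (ToricPublishedInputs ∧ Milne1972.bsdQuotient_baseChange_quadratic_anyModel) →
      (Literature.NumberTheory.EllipticCurves.rank_eq_analyticRank_of_analyticRank_le_one ∧ WeierstrassCurve.hasEntireLFunction_rat ∧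
        WeierstrassCurve.bsdRHS_eq_of_isIsogenous ∧ Literature.NumberTheory.EllipticCurves.bsdTriple_of_hasCM_of_L_one_ne_zero ∧
        Literature.NumberTheory.EllipticCurves.KrizLi2019.thm112_bsdTwo_twist) →
    ∀ (W : WeierstrassCurve ℚ) [W.IsElliptic] [W.IsGloballyMinimal], W.HasCM → W.analyticRank = 1 → CMSplit W 2 → ¬ Good W 2 →
      ∀ (N : ℕ) [NeZero N] (K : Type) [Field K] [NumberField K] (Dt : ModularParametrizationData W N)
        (H : HeegnerDatum N (NumberField.discr K)) (ι : K →+* ℂ) (P : (W.baseChange K).toAffine.Point),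
        W.conductorNorm ℤ = N → IsImaginaryQuadratic K → SatisfiesHeegnerHypothesis N K → NumberField.discr K < -4 →
        (W.quadraticTwist (NumberField.discr K : ℚ)).entireLFunction 1 ≠ 0 → (W.baseChange K).analyticRank = 1 →
        WeierstrassCurve.Affine.Point.map ι.toRatAlgHom P = heegnerPointComplex Dt H → ¬ IsOfFinAddOrder P →
        (W.baseChange K).mordellWeilRank = 1 → Finite (W.baseChange K).sha →
        (padicValNat 2 (Nat.card (AddCommGroup.primaryComponent (W.baseChange K).sha 2)) : ℤ) +
            (padicValNat 2 (W.baseChange K).tamagawaProduct : ℤ) ≤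
          2 * (padicValNat 2 (AddSubgroup.zmultiples P).index : ℤ) - 2 * (padicValNat 2 Dt.c.natAbs : ℤ) :=
  fun hPr hB ↦ stubUpperText_of_forall_upperOverC_twistField hPr hB h49 hTF

/-- `stub_heegnerIndexUpperAtTwo` — its displayed type verbatim — from the CM-field UPPER halves over `K₀ = ℚ(√−7)` (p641230) and GZ I.(7.3). -/
theorem stub_heegnerIndexUpperAtTwo_of_forall_upperOverCMField (hGZ : GrossZagier1986_thm_I_7_3)
    (hK0 : ∀ (W : WeierstrassCurve ℚ) [W.IsElliptic] [W.IsGloballyMinimal], W.HasCM → W.analyticRank = 1 →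
      CMSplit W 2 → ¬ Good W 2 → ∀ (K : Type) [Field K] [NumberField K], IsImaginaryQuadratic K →
      NumberField.discr K = -7 → MissingUpperBoundOverCAt (W.baseChange K) 2) :
    (ToricPublishedInputs ∧ Milne1972.bsdQuotient_baseChange_quadratic_anyModel) →
      (Literature.NumberTheory.EllipticCurves.rank_eq_analyticRank_of_analyticRank_le_one ∧ WeierstrassCurve.hasEntireLFunction_rat ∧
        WeierstrassCurve.bsdRHS_eq_of_isIsogenous ∧ Literature.NumberTheory.EllipticCurves.bsdTriple_of_hasCM_of_L_one_ne_zero ∧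
        Literature.NumberTheory.EllipticCurves.KrizLi2019.thm112_bsdTwo_twist) →
    ∀ (W : WeierstrassCurve ℚ) [W.IsElliptic] [W.IsGloballyMinimal], W.HasCM → W.analyticRank = 1 → CMSplit W 2 → ¬ Good W 2 →
      ∀ (N : ℕ) [NeZero N] (K : Type) [Field K] [NumberField K] (Dt : ModularParametrizationData W N)
        (H : HeegnerDatum N (NumberField.discr K)) (ι : K →+* ℂ) (P : (W.baseChange K).toAffine.Point),
        W.conductorNorm ℤ = N → IsImaginaryQuadratic K → SatisfiesHeegnerHypothesis N K → NumberField.discr K < -4 →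
        (W.quadraticTwist (NumberField.discr K : ℚ)).entireLFunction 1 ≠ 0 → (W.baseChange K).analyticRank = 1 →
        WeierstrassCurve.Affine.Point.map ι.toRatAlgHom P = heegnerPointComplex Dt H → ¬ IsOfFinAddOrder P →
        (W.baseChange K).mordellWeilRank = 1 → Finite (W.baseChange K).sha →
        (padicValNat 2 (Nat.card (AddCommGroup.primaryComponent (W.baseChange K).sha 2)) : ℤ) +
            (padicValNat 2 (W.baseChange K).tamagawaProduct : ℤ) ≤
          2 * (padicValNat 2 (AddSubgroup.zmultiples P).index : ℤ) - 2 * (padicValNat 2 Dt.c.natAbs : ℤ) :=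
  fun hPr hB ↦ stubUpperText_of_forall_upperOverCMField hPr hB hGZ hK0

end Summit.BirchSwinnertonDyer.BirchSwinnertonDyer.Theorems.PrintCf2.UpperStubGlue

end
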